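import Mathlib
import HarnessLib.Audit
import Summits.PneNP.PneNP.Theorems.PstarGateNodesX
import Summits.PneNP.PneNP.Theorems.PstarGateCasePNor
import Summits.PneNP.PneNP.Theorems.PstarNorUnitDir
import Summits.PneNP.PneNP.Theorems.PstarGateUnitCycleAffine

/-!
# One GATED chord, node N1 (CASE P with a (NOR) chord): the NOR literals and the gate partner MEET EVERY EDGE of the gated cycle (E2; prover-1 g18)

FRONTIER range-avoidance ladder, rung F-N3 (`stmt-PneNP-19007`), cell `pnp-ideate` (`PstarGateNodesX.GateCasePNorX`; this seat's
`HOME/pnp-ideate-prover-1/g18/E2-PLAN-v3.md` §3); restricted-model proof complexity — nothing here bears on `P` versus `NP`.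

CASE P (the other chords read along the gate's own direction `(1,0)`), a chord `e' ≠ e` that is (NOR) w.r.t. `q = q_{(1,0)}`
(`PstarGateCasePRegimes.NorCert`).  Then:

* `zpoint_caseP` — (M0) at the gated chord + (T3): a base point `a` with `q(a) = 0` and the gate coefficient `ℓ(a) ≠ 0` (single-read second
  coordinate; if `ℓ(a) = 0` the M-witness of `e` is an admissible solution);
* `polarDir_eq_of_agree` — a linear functional `x ↦ polarDir(x, b)` killed by the basis vectors outside `Γ` only sees the `Γ`-coordinates;
* `caseP_nor_through` — **the clean `PstarNorUnitDir.nor_unit_of_dir` applies verbatim to `e'`** (model-level): `D e' = {j₁, j₂}` is a CONS-T pair with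
  literals `σ ∈ j₁`, `τ ∈ j₂`, and `q` depends on `x_σ, x_τ` only; so on the coordinate flat `{x_σ = a_σ, x_τ = a_τ, x_u = a_u}` we have `q = 0` and
  `ℓ = ℓ(a) ≠ 0`, the gated chord is ON there (`PstarGateBridge.caseP_forced`), `Q_{D e}` is constant on the flat, and
  `PstarGateCasePNor.through_of_const_on_flat` gives: **every edge of `D e` has an AND variable in `{σ, τ, u}`**.
This is the structural input of the N1 count (memo §3: with the clean NOR core `U ⊇ D e' + e'` of `caseP_nor_units` and the gate as payer, the edges of
`D e` off `U` each lose a boundary slot).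
-/

set_option linter.dupNamespace false -- `Summit.PneNP.PneNP.…`: summit = sub-problem name (D-0017 single-conjunct layout)

open Finset Module Literature.Computability.Complexity
open Summit.PneNP.PneNP.Theorems.PstarTyped (Typed)
open Summit.PneNP.PneNP.Theorems.PstarSALevel (BoundaryExpanding SimpleOverlap)
open Summit.PneNP.PneNP.Theorems.PstarGapLinearised (andPair)
open Summit.PneNP.PneNP.Theorems.PstarCoreBound (XorClosed)
open Summit.PneNP.PneNP.Theorems.PstarCubeIdeals (IsAffineFn)
open Summit.PneNP.PneNP.Theorems.PstarProductRank (qform polar)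
open Summit.PneNP.PneNP.Theorems.PstarReadSumset (V2)
open Summit.PneNP.PneNP.Theorems.PstarChordSystem (ChordSystem)
open Summit.PneNP.PneNP.Theorems.PstarChordBridgeTools (privs coef)
open Summit.PneNP.PneNP.Theorems.PstarChordBridge (BridgeData sys Solution Lift infeasible_of_not_solution chordMinimal_of_solution_erase)
open Summit.PneNP.PneNP.Theorems.PstarChordBridgeCotree (Peelable)
open Summit.PneNP.PneNP.Theorems.PstarChordBridgeForcing (gam freeMon)
open Summit.PneNP.PneNP.Theorems.PstarChordBridgeBasis (qDir polarDir)
open Summit.PneNP.PneNP.Theorems.PstarNorUnitDir (nor_unit_of_dir)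
open Summit.PneNP.PneNP.Theorems.PstarGateBridge (GateHyp gate_reads caseP_forced)
open Summit.PneNP.PneNP.Theorems.PstarGateCasePRegimes (NorCert)
open Summit.PneNP.PneNP.Theorems.PstarGateCasePNor (through_of_const_on_flat)
open Summit.PneNP.PneNP.Theorems.PstarGateUnitCycleAffine (qDir_one_zero)
open Summit.PneNP.PneNP.Theorems.PstarGateNodes (GateData ReadAlong AllRead)
open Summit.PneNP.PneNP.Theorems.PstarGateNodesX (GateDataX)

namespace Summit.PneNP.PneNP.Theorems.PstarGateCasePNorThrough

variable {n m : ℕ}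

/-- **(M0) at the gated chord in CASE P**: a point of `Z(q)` where the gate coefficient is on. -/
theorem zpoint_caseP (I : LocalMap 4 n m) (hI : I.IsPure xorAndPred) (hT : Typed I) {B : BridgeData n m} (hW : B.WF I) (hL : Lift I B)
    {e : Fin m} (hG : GateHyp I B e) (hP2 : ∀ e' ∈ B.N, e' ≠ e → ∀ a, ((sys I B).ρ e' a).2 = 0 ∧ ((sys I B).ρ' e' a).2 = 0)
    (hT3 : ¬ ∃ z, Solution I B B.J₀ z) (hM0e : ∃ z, Solution I B (B.J₀.erase e) z) :
    ∃ a : Fin n → ZMod 2, qDir I B (1, 0) a = 0 ∧ coef I B.C₁ B.G₁ (I.vars e 2) a ≠ 0 := by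
  classical
  have he : e ∈ B.N := hG.1
  have hinf : (sys I B).Infeasible B.N := infeasible_of_not_solution I hI hT hW hL hT3
  obtain ⟨z, hz⟩ := hM0e
  obtain ⟨a, s, hadm, hval⟩ := chordMinimal_of_solution_erase I hI hT hW he hz
  -- every contribution has zero second coordinate
  have hc2 : ∀ s' : Fin m → ZMod 2 × ZMod 2, ∀ i ∈ B.N, ((sys I B).contrib a s' i).2 = 0 := by
    intro s' i hi
    unfold ChordSystem.contrib
    by_cases hie : i = e
    · subst hie
      rw [(gate_reads I hI hG a).1, (gate_reads I hI hG a).2, smul_zero, add_zero, Prod.smul_snd, smul_eq_mul, mul_zero]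
    · rw [Prod.snd_add, Prod.smul_snd, Prod.smul_snd, (hP2 i hi hie a).1, (hP2 i hi hie a).2, smul_eq_mul, smul_eq_mul, mul_zero, mul_zero,
        add_zero]
  refine ⟨a, ?_, fun hc => ?_⟩
  · have h2 := congrArg Prod.snd hval
    unfold ChordSystem.val at h2
    rw [Prod.snd_add, Prod.snd_sum, sum_eq_zero (hc2 s), add_zero] at h2
    rw [qDir_one_zero, h2, CharTwo.add_self_eq_zero]
  · -- with `ℓ(a) = 0` the chord `e` contributes nothing: make its state admissible
    set s' := Function.update s e (1, (sys I B).u e a) with hs'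
    have hadm' : (sys I B).Adm B.N a s' := by
      intro i hi
      by_cases hie : i = e
      · subst hie; rw [hs', Function.update_self, one_mul]
      · rw [hs', Function.update_of_ne hie]; exact hadm i (mem_erase.2 ⟨hie, hi⟩)
    have hce : ∀ t : Fin m → ZMod 2 × ZMod 2, (sys I B).contrib a t e = 0 := by
      intro t
      unfold ChordSystem.contrib
      rw [(gate_reads I hI hG a).1, (gate_reads I hI hG a).2, hc, smul_zero, add_zero]
      ext <;> simp
    have hval' : (sys I B).val B.N a s' = (sys I B).val B.N a s := by
      rw [(sys I B).val_eq he, (sys I B).val_eq he, hce, hce, hs', (sys I B).val_erase_update]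
    exact hinf a s' hadm' (by rw [hval']; exact hval)

/-- A linear functional killed by the basis vectors outside `Γ` depends on the `Γ`-coordinates only. -/
theorem polarDir_eq_of_agree (I : LocalMap 4 n m) (B : BridgeData n m) (mv : V2) (b : Fin n → ZMod 2) (Γ : Finset (Fin n))
    (hΓ : ∀ v ∉ Γ, polarDir I B mv (Pi.single v 1) b = 0) {x x' : Fin n → ZMod 2} (hxx' : ∀ v ∈ Γ, x v = x' v) :
    polarDir I B mv x b = polarDir I B mv x' b := by
  classical
  have hd : x = x' + (x - x') := by abel
  rw [hd, LinearMap.map_add₂]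
  suffices h : polarDir I B mv (x - x') b = 0 by rw [h, add_zero]
  rw [← Finset.univ_sum_single (x - x'), LinearMap.map_sum₂]
  refine sum_eq_zero fun v _ => ?_
  by_cases hv : v ∈ Γ
  · rw [Pi.sub_apply, hxx' v hv, sub_self, Pi.single_zero, LinearMap.map_zero₂]
  · have h01 : ∀ t : ZMod 2, t = 0 ∨ t = 1 := by decide
    rcases h01 ((x - x') v) with h | h
    · rw [h, Pi.single_zero, LinearMap.map_zero₂]
    · rw [h]; exact hΓ v hv

/-- **CASE P with a (NOR) chord: the NOR literals `σ, τ` and the gate partner `u` meet every edge of `D e`.** -/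
theorem caseP_nor_through (I : LocalMap 4 n m) (hI : I.IsPure xorAndPred) (hT : Typed I) (hS : SimpleOverlap I) {r : ℕ}
    (hB : BoundaryExpanding r I) {B : BridgeData n m} {e g₀ : Fin m} {u : Fin n} {κ₀ : ZMod 2} (hD : GateDataX I r B e g₀ u κ₀)
    (hRA : ReadAlong I B e (1, 0)) (hread : AllRead I B e) {e' : Fin m} (he' : e' ∈ B.N) (hnor : NorCert I B (B.D e') (gam B e')) :
    ∃ j₁ j₂ : Fin m, ∃ σ τ : Fin n, j₁ ≠ j₂ ∧ B.D e' = {j₁, j₂} ∧ Disjoint (andPair I j₁) (andPair I j₂) ∧ σ ∈ andPair I j₁ ∧ τ ∈ andPair I j₂ ∧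
      (∃ g ∈ B.T₁ ∪ freeMon I B.N B.G₁ ∪ (B.T₂ ∪ freeMon I B.N B.G₂), σ ∈ andPair I g ∧ τ ∈ andPair I g) ∧
      ∀ j ∈ B.D e, I.vars j 2 ∈ ({σ, τ, u} : Finset (Fin n)) ∨ I.vars j 3 ∈ ({σ, τ, u} : Finset (Fin n)) := by
  classical
  obtain ⟨-, hW, hr, hd₁, hd₂, hL, -, -, hG, -, -, -, -, -, -, hcoef, hT3, hM0⟩ := id hD
  have he : e ∈ B.N := hG.1
  have he'G : e' ∉ B.G₁ ∪ B.G₂ := by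
    intro h
    rcases mem_union.1 h with h | h
    · exact disjoint_left.1 hd₁ h (hW.hN he')
    · exact disjoint_left.1 hd₂ h (hW.hN he')
  obtain ⟨a, b, -, hq, m₁, m₂, hm₁, hm₂, hQ⟩ := hnor
  obtain ⟨j₁, j₂, σ, τ, hne12, hDe', hdisj, hσ, hτ, hlit, hreal⟩ :=
    nor_unit_of_dir I hI hS hB hW hr he' he'G (1, 0) hq hm₁ hm₂ hQ
  refine ⟨j₁, j₂, σ, τ, hne12, hDe', hdisj, hσ, hτ, hreal, ?_⟩
  -- the literal functionals vanish on basis vectors outside `{σ, τ}`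
  have hΓb : ∀ v ∉ ({σ, τ, u} : Finset (Fin n)), polarDir I B (1, 0) (Pi.single v 1) b = 0 := by
    intro v hv
    by_contra h
    have := (hlit v).1 (Or.inl h)
    exact hv (by rw [mem_insert, mem_insert]; rcases this with h' | h' <;> simp [h'])
  have hΓa : ∀ v ∉ ({σ, τ, u} : Finset (Fin n)), polarDir I B (1, 0) (Pi.single v 1) a = 0 := by
    intro v hv
    by_contra h
    have := (hlit v).1 (Or.inr h)
    exact hv (by rw [mem_insert, mem_insert]; rcases this with h' | h' <;> simp [h'])
  -- CASE P data in pointwise form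
  have hP2 : ∀ i ∈ B.N, i ≠ e → ∀ x, ((sys I B).ρ i x).2 = 0 ∧ ((sys I B).ρ' i x).2 = 0 := by
    intro i hi hie x
    obtain ⟨h1, h2⟩ := hRA i hi hie x
    constructor
    · rcases h1 with h | h
      · rw [h]; rfl
      · rw [h]
    · rcases h2 with h | h
      · rw [h]; rfl
      · rw [h]
  -- the base point and the flat
  obtain ⟨x₀, hq₀, hc₀⟩ := zpoint_caseP I hI hT hW hL hG hP2 hT3 (hM0 e (hW.hN he))
  refine through_of_const_on_flat I hI hS (B.D e) {σ, τ, u} x₀ (gam B e + 1) fun x hx => ?_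
  have hxq : qDir I B (1, 0) x = 0 := by
    rw [hq, polarDir_eq_of_agree I B (1, 0) b {σ, τ, u} hΓb hx, polarDir_eq_of_agree I B (1, 0) a {σ, τ, u} hΓa hx, ← hq]
    exact hq₀
  have hxc : coef I B.C₁ B.G₁ (I.vars e 2) x ≠ 0 := by
    rw [hcoef, hx u (by simp), ← hcoef]; exact hc₀
  exact (caseP_forced I hI hT hW hL hG hT3 hRA hread hxq).2 hxc

end Summit.PneNP.PneNP.Theorems.PstarGateCasePNorThrough
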